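import Mathlib
import Literature.NumberTheory.Automorphic.FuchsianMaassCuspForms
import Literature.NumberTheory.Automorphic.FuchsianEisensteinTruncation
import Literature.NumberTheory.Automorphic.CuspHeightIsometry

/-!
# Pseudo-cusp forms of height `Y` and the compact compressed operators `T^Y_k = P_Y T_k P_Y`
(Iwaniec, *Spectral Methods of Automorphic Forms*, GSM 53, §4.2–4.3 (Prop. 4.3, Cor. 4.4, Prop. 4.5,
the Hilbert–Schmidt step of Thm 4.7), §6.4 (6.29) (truncated Eisenstein series), PDF pp. 49–52, 88;
Garrett, *Modern Analysis of Automorphic Forms by Example*, vol. 1, §1.15 "Exotic eigenfunctions,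
discreteness of pseudo-cuspforms" (the space `L²_b` of pseudo-cuspforms, Thm 1.15.1: the
pseudo-Laplacian `Δ̃_b` on `L²_b` has compact resolvent), PDF p. 74; Colin de Verdière,
*Pseudo-laplaciens II* (1983))

Seventeenth brick of the general-`Γ` Eisenstein series, opening **Chapter 6 (the meromorphic
continuation of `E_𝔞(z, s)`)** for a general finite volume group on the way to
`Literature.NumberTheory.Automorphic.Iwaniec2002_eq_12_5` / `Iwaniec2002_thm_12_1` (what remains
there is `Fuchsian.SpectralParts`, `FuchsianCuspidalResolution.lean`: the continued Eisenstein series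
on `Re s = 1/2`, their residues, and Theorem 7.3). Iwaniec continues `E_𝔞(z, s)` by Selberg's
Fredholm-determinant method applied to the automorphic Green function (§6.1–6.2); we follow instead
Colin de Verdière's idea — the Eisenstein series is recovered from the resolvent of a self-adjoint
operator with *discrete* spectrum on the space of pseudo-cusp forms — in a bounded form adapted to
the tree: the pseudo-Laplacian `Δ̃_b` (a Friedrichs extension) is replaced by the compressions
`P_Y T_k P_Y` of the invariant integral operators `T_k` (bounded, self-adjoint, commuting with `Δ`),
which this file shows to be COMPACT. Everything here is proved; no fact is introduced.

1. (§1) `pseudoCuspSubmodule hΓ hneg hd hF σ Y = L²_Y ⊆ L²(F)`: the classes whose automorphic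
   extension has vanishing cusp mean a.e. above the height `Y` at every cusp `σ_i ∞` (Garrett's
   `L²_b = {f : c_P f(a_y) = 0 for y > b}`); it contains the cuspidal subspace, increases with `Y`,
   and is CLOSED (`isClosed_pseudoCuspSubmodule`: the cusp-mean maps are continuous `L²(F) → L¹_loc`,
   as in `FuchsianCuspidalSubspace`), hence a Hilbert space.
2. (§2) classes of automorphic `L²` functions whose constant terms vanish above `Y` lie in `L²_Y`
   (`toLp_mem_pseudoCuspSubmodule`, with `cuspMeanAt_eq_of_im` of `CuspHeightIsometry`); in particular **the truncated Eisenstein series `E^Y_𝔞ᵢ(·, s)` of (6.29)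
   are pseudo-cusp forms** for `Re s > 1`, `Y ≥ 1` (`eisTrunc_mem_pseudoCuspSubmodule`).
3. (§3) `pseudoCuspKernelCLM … Y hk hkc = T^Y_k := P_Y ∘ T_k ∘ ι` on `L²_Y` (`P_Y` the orthogonal
   projection): `⟪T^Y_k f, g⟫ = ⟪T_k f, g⟫`, symmetric, self-adjoint.
4. (§4) **cusp decay for pseudo-cusp forms** (`norm_kernelOp_frame_le_of_pseudoCusp`): for a Lipschitz
   test kernel `k` supported in `u ≤ M` and `g ∈ L²(F)` whose cusp mean at `𝔞_i` vanishes a.e. above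
   `Y`, `|T_k g(σ_i z)| ≤ C_k (Im z)^{-1/2} ‖g‖` as soon as `Im z > e^{R_M+1}` and
   `Im z e^{-(R_M+1)} > Y` — Propositions 4.3–4.5 only use the vanishing of the cusp mean on the ball
   of radius `R_M` about `z` (`invariantOperator_eq_zero_of_ae_ball`).
5. (§5) **compactness**: `T_k ∘ ι : L²_Y → L²(F)` is compact for every Lipschitz test kernel
   (`isCompactOperator_kernelCLM_comp_pseudoCuspSubtype`; total boundedness of the image of the unit
   ball exactly as in `FuchsianCuspFormsCompact`, the truncation height being raised above
   `e^{R_M+1}(|Y| + 1)`), hence so is `T^Y_k` (`isCompactOperator_pseudoCuspKernelCLM`) — the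
   discreteness of the spectrum of `T^Y_k` away from `0` is the input of the continuation in the
   sequel (`FuchsianEisensteinContinuation`).

## References
* [Iwaniec2002] H. Iwaniec, *Spectral Methods of Automorphic Forms*, 2nd ed., GSM 53, AMS 2002,
  §4.2–4.3, PDF pp. 49–52; (6.29), PDF p. 88 (held copy `book:iwaniec2002-spectral-methods-automorphic-forms`).
* [Garrett2018] P. Garrett, *Modern Analysis of Automorphic Forms by Example*, vol. 1, CUP 2018,
  §1.15, PDF p. 74 (held copy `book:garrett2018-modern-analysis-automorphic-forms-by-example`).
* [Colindeverdiere1983] Y. Colin de Verdière, *Pseudo-laplaciens II*, Ann. Inst. Fourier 33 (1983) 87–113.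

Mathlib: `Submodule.orthogonalProjectionOnto`, `Submodule.inner_orthogonalProjectionOnto_eq_of_mem_right/left`,
`IsCompactOperator.clm_comp`, `isCompactOperator_iff_isCompact_closure_image_closedBall`,
`TotallyBounded.exists_subset`, `Lp.norm_le_of_ae_bound`. Literature: `cuspMeanAt`, `cuspSubmodule`,
`lintegral_enorm_cuspMeanAt_autExt_le`, `lintegral_rpow_eq_enorm'` (`FuchsianCuspidalSubspace`);
`frameCuspConst`, `lintegral_sq_autExt_frame_closedBall_le`, `norm_eq_sqrt_lintegral'`, `kernelOp_coe_sub'`,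
`orbitBoundAt`, `integral_norm_autExt_closedBall_le'` (`FuchsianCuspFormsCompact`); `kernelRadius`, `oscConst`,
`norm_invariantOperator_sub_le`, `norm_invariantOperator_le'`, `continuous_invariantOperator`,
`norm_le_of_cuspMean_eq_zero`, `integral_norm_le_sqrt_mul_sqrt`, `volume_closedBall_eq`,
`rpow_neg_one_half_eq_one_div_sqrt` (`CuspFormsCompact`); `kernelCLM`, `kernelCLM_isSymmetric`,
`kernelOp_eq_invariantOperator`, `autExt` & co. (`AutomorphicKernelOperators`); `cuspMean_vadd`,
`cuspMean_invariantOperator`, `autExt_ae_eq_of_isAutomorphic`, `isAutomorphic_kernelOp`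
(`CuspidalSubspace`); `invHeight`, `exists_compact_of_invHeight_le`, `exists_smul_mem_cuspStrip_of_lt`
(`FuchsianInvariantHeight`); `upperRightHom_smul`, `upperRightHom_one_mem_of_periods` (`FuchsianCuspZones`);
`mem_conj_inv_iff` (`FuchsianGroupCusps`); `eisTrunc`, `memLp_eisTrunc`, `isAutomorphic_eisTrunc`,
`cuspMeanAt_eisTrunc_eq_zero` (`FuchsianEisensteinTruncation`).
-/

noncomputable section

open MeasureTheory Set Filter Real UpperHalfPlane
open scoped Topology MatrixGroups ComplexConjugate NNReal ENNReal Pointwise InnerProductSpace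

namespace Literature.NumberTheory.Automorphic

namespace Fuchsian

variable {Γ : Subgroup (GL (Fin 2) ℝ)} {F : Set ℍ} {h : ℕ} {𝔞 : Fin h → OnePoint ℝ} {σ : Fin h → SL(2, ℝ)}

/-! ## 1. The space of pseudo-cusp forms of height `Y` -/

section Subspace

variable (hΓ : Γ ≤ (Matrix.SpecialLinearGroup.toGL : SL(2, ℝ) →* GL (Fin 2) ℝ).range)
  (hneg : (-1 : GL (Fin 2) ℝ) ∈ Γ) (hd : IsDiscreteSubgroup Γ) (hF : IsHypFundamentalDomain Γ F)
  (σ : Fin h → SL(2, ℝ)) (Y : ℝ)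

include hΓ hneg hd hF in
/-- **The space of pseudo-cusp forms of height `Y`**, `L²_Y(Γ\ℍ) ⊆ L²(F)`: the classes `g` whose
automorphic extension `g^Γ` has vanishing cusp mean `(g^Γ)_{𝔞_i}(w) = ∫_0^1 g^Γ(σ_i(w + ξ)) dξ = 0`
for a.e. `w` of height `Im w > Y`, at every cusp (Garrett's space `L²_b` of pseudo-cuspforms,
"`{f ∈ L²(Γ\G/K) : c_P f(a_y) = 0` for `y > b`}"; for `Y ≤ 0` this is the cuspidal subspace
`Fuchsian.cuspSubmodule`). The truncated Eisenstein series `E^Y_𝔞(·, s)` of (6.29) lie in it.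
[cite: Garrett2018, §1.15, PDF p. 74; Iwaniec2002, (6.29), PDF p. 88] -/
def pseudoCuspSubmodule : Submodule ℂ (Lp ℂ 2 ((volume : Measure ℍ).restrict F)) where
  carrier := {g | ∀ i, ∀ᵐ w : ℍ, Y < w.im → cuspMeanAt (σ i) (autExt Γ F g) w = 0}
  zero_mem' := by
    intro i
    have h0 : autExt Γ F (⇑(0 : Lp ℂ 2 ((volume : Measure ℍ).restrict F))) =ᵐ[volume]
        autExt Γ F (fun _ => (0 : ℂ)) :=
      autExt_congr_ae hΓ hneg hd hF (Lp.coeFn_zero ℂ 2 _)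
    have h1 : autExt Γ F (fun _ => (0 : ℂ)) = fun _ => 0 := by
      funext z; simp [autExt]
    rw [h1] at h0
    filter_upwards [cuspMeanAt_congr_ae h0 (σ i)] with w hw _
    rw [hw, cuspMeanAt_zero]
  add_mem' := by
    intro f g hf hg i
    have h1 : autExt Γ F (⇑(f + g)) =ᵐ[volume] autExt Γ F (fun z => f z + g z) :=
      autExt_congr_ae hΓ hneg hd hF (Lp.coeFn_add f g)
    have h2 := autExt_add_ae hΓ hneg hd hF (⇑f) (⇑g)
    have h3 := cuspMeanAt_congr_ae (h1.trans h2) (σ i)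
    have hfi := ae_intervalIntegrable_comp_sl_smul_vadd (locallyIntegrable_autExt hΓ hneg hd hF (Lp.memLp f)) (σ i)
    have hgi := ae_intervalIntegrable_comp_sl_smul_vadd (locallyIntegrable_autExt hΓ hneg hd hF (Lp.memLp g)) (σ i)
    filter_upwards [h3, hfi, hgi, hf i, hg i] with w hw hfw hgw hf0 hg0 hY
    rw [hw, cuspMeanAt_add hfw hgw, hf0 hY, hg0 hY]
    simp
  smul_mem' := by
    intro c g hg i
    have h1 : autExt Γ F (⇑(c • g)) =ᵐ[volume] autExt Γ F (fun z => c * g z) :=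
      autExt_congr_ae hΓ hneg hd hF (Lp.coeFn_smul c g)
    have h2 : autExt Γ F (fun z => c * g z) = fun z => c * autExt Γ F g z := by
      funext z; exact autExt_const_mul c g z
    rw [h2] at h1
    filter_upwards [cuspMeanAt_congr_ae h1 (σ i), hg i] with w hw hg0 hY
    rw [hw, cuspMeanAt_const_mul, hg0 hY]
    simp

/-- Membership unfolding. [folklore] -/
theorem mem_pseudoCuspSubmodule_iff (g : Lp ℂ 2 ((volume : Measure ℍ).restrict F)) :
    g ∈ pseudoCuspSubmodule hΓ hneg hd hF σ Y ↔
      ∀ i, ∀ᵐ w : ℍ, Y < w.im → cuspMeanAt (σ i) (autExt Γ F g) w = 0 := Iff.rfl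

/-- Cusp forms are pseudo-cusp forms of every height. [cite: Garrett2018, §1.15, PDF p. 74] -/
theorem cuspSubmodule_le_pseudoCuspSubmodule :
    cuspSubmodule hΓ hneg hd hF σ ≤ pseudoCuspSubmodule hΓ hneg hd hF σ Y := by
  intro g hg i
  filter_upwards [(mem_cuspSubmodule_iff hΓ hneg hd hF σ g).mp hg i] with w hw _
  exact hw

/-- The spaces increase with the height. [folklore] -/
theorem pseudoCuspSubmodule_mono {Y Y' : ℝ} (hYY' : Y ≤ Y') :
    pseudoCuspSubmodule hΓ hneg hd hF σ Y ≤ pseudoCuspSubmodule hΓ hneg hd hF σ Y' := by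
  intro g hg i
  filter_upwards [hg i] with w hw hY'
  exact hw (lt_of_le_of_lt hYY' hY')

/-- **`L²_Y` is closed in `L²(F)`** (each cusp-mean map is continuous into `L¹_loc`; same proof as
for the cuspidal subspace, localised to the heights `> Y`). [cite: Garrett2018, §1.15, PDF p. 74] -/
theorem isClosed_pseudoCuspSubmodule :
    IsClosed (pseudoCuspSubmodule hΓ hneg hd hF σ Y : Set (Lp ℂ 2 ((volume : Measure ℍ).restrict F))) := by
  refine IsSeqClosed.isClosed fun u g hu hug => ?_
  rw [SetLike.mem_coe, mem_pseudoCuspSubmodule_iff]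
  intro i
  have hSm : MeasurableSet {w : ℍ | Y < w.im} :=
    measurableSet_lt measurable_const UpperHalfPlane.continuous_im.measurable
  suffices hball : ∀ n : ℕ, ∀ᵐ w : ℍ, w ∈ Metric.closedBall UpperHalfPlane.I n →
      {w : ℍ | Y < w.im}.indicator (cuspMeanAt (σ i) (autExt Γ F g)) w = 0 by
    rw [← ae_all_iff] at hball
    filter_upwards [hball] with w hw hY
    obtain ⟨n, hn⟩ := exists_nat_ge (dist w UpperHalfPlane.I)
    have := hw n (Metric.mem_closedBall.mpr hn)
    rwa [indicator_of_mem (show w ∈ {w : ℍ | Y < w.im} from hY)] at this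
  intro n
  obtain ⟨K, hK, hest⟩ := lintegral_enorm_cuspMeanAt_autExt_le hΓ hneg hd hF (σ i) UpperHalfPlane.I n
  set Φ : ℍ → ℂ := {w : ℍ | Y < w.im}.indicator (cuspMeanAt (σ i) (autExt Γ F g)) with hΦ
  have hΦm : AEStronglyMeasurable Φ volume :=
    (aestronglyMeasurable_cuspMean (aestronglyMeasurable_comp_sl_smul
      (aestronglyMeasurable_autExt hΓ hneg hd hF (Lp.memLp g).1) (σ i))).indicator hSm
  have hbound : ∀ m : ℕ, ∫⁻ w in Metric.closedBall UpperHalfPlane.I n, ‖Φ w‖ₑ ≤ K * ‖g - u m‖ₑ := by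
    intro m
    have hum := hu m i
    have h1 : autExt Γ F (⇑g) =ᵐ[volume] autExt Γ F (fun z => (g - u m) z + (u m) z) := by
      refine autExt_congr_ae hΓ hneg hd hF ?_
      filter_upwards [Lp.coeFn_sub g (u m)] with z hz
      rw [hz]; simp
    have h2 := autExt_add_ae hΓ hneg hd hF (⇑(g - u m)) (⇑(u m))
    have h3 := cuspMeanAt_congr_ae (h1.trans h2) (σ i)
    have hfi := ae_intervalIntegrable_comp_sl_smul_vadd (locallyIntegrable_autExt hΓ hneg hd hF (Lp.memLp (g - u m))) (σ i)
    have hgi := ae_intervalIntegrable_comp_sl_smul_vadd (locallyIntegrable_autExt hΓ hneg hd hF (Lp.memLp (u m))) (σ i)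
    have h4 : ∀ᵐ w ∂volume, ‖Φ w‖ₑ ≤ ‖cuspMeanAt (σ i) (autExt Γ F (⇑(g - u m))) w‖ₑ := by
      filter_upwards [h3, hfi, hgi, hum] with w hw hfw hgw hu0
      by_cases hY : Y < w.im
      · rw [hΦ, indicator_of_mem (show w ∈ {w : ℍ | Y < w.im} from hY), hw, cuspMeanAt_add hfw hgw, hu0 hY,
          add_zero]
      · rw [hΦ, indicator_of_notMem (show w ∉ {w : ℍ | Y < w.im} from hY), enorm_zero]
        exact bot_le
    calc ∫⁻ w in Metric.closedBall UpperHalfPlane.I n, ‖Φ w‖ₑ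
        ≤ ∫⁻ w in Metric.closedBall UpperHalfPlane.I n, ‖cuspMeanAt (σ i) (autExt Γ F (⇑(g - u m))) w‖ₑ :=
          lintegral_mono_ae (ae_restrict_of_ae h4)
      _ ≤ K * (∫⁻ w in F, ‖(g - u m) w‖ₑ ^ 2) ^ (1 / 2 : ℝ) := hest _ (Lp.memLp (g - u m)).1
      _ = K * ‖g - u m‖ₑ := by rw [lintegral_rpow_eq_enorm']
  have htend : Tendsto (fun m => K * ‖g - u m‖ₑ) atTop (𝓝 0) := by
    have h1 : Tendsto (fun m => ‖g - u m‖ₑ) atTop (𝓝 0) := by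
      have h2 : Tendsto (fun m => g - u m) atTop (𝓝 0) := by
        have := (tendsto_const_nhds (x := g)).sub hug
        rwa [sub_self] at this
      have h3 := (continuous_enorm.tendsto (0 : Lp ℂ 2 ((volume : Measure ℍ).restrict F))).comp h2
      rw [enorm_zero] at h3
      exact h3
    have h4 := ENNReal.Tendsto.const_mul h1 (Or.inr hK)
    rwa [mul_zero] at h4
  have hzero : ∫⁻ w in Metric.closedBall UpperHalfPlane.I n, ‖Φ w‖ₑ = 0 :=
    le_antisymm (ge_of_tendsto' htend hbound) bot_le
  rw [lintegral_eq_zero_iff' hΦm.restrict.aemeasurable.enorm] at hzero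
  rw [← ae_restrict_iff' measurableSet_closedBall]
  filter_upwards [hzero] with w hw
  simpa using hw

/-- `L²_Y`, being closed, is a Hilbert space. [cite: Garrett2018, §1.15, PDF p. 74] -/
instance completeSpace_pseudoCuspSubmodule : CompleteSpace (pseudoCuspSubmodule hΓ hneg hd hF σ Y) :=
  (isClosed_pseudoCuspSubmodule hΓ hneg hd hF σ Y).completeSpace_coe

end Subspace

/-! ## 2. Classes of automorphic functions with vanishing high constant terms; `E^Y_𝔞(·, s) ∈ L²_Y` -/

section Classes

variable (hΓ : Γ ≤ (Matrix.SpecialLinearGroup.toGL : SL(2, ℝ) →* GL (Fin 2) ℝ).range)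
  (hneg : (-1 : GL (Fin 2) ℝ) ∈ Γ) (hd : IsDiscreteSubgroup Γ) (hF : IsHypFundamentalDomain Γ F)
  (hper : ∀ i, (ConjAct.toConjAct (Matrix.SpecialLinearGroup.toGL (σ i) : GL (Fin 2) ℝ)⁻¹ • Γ).strictPeriods =
    AddSubgroup.zmultiples 1)

include hper in
/-- **Classes of automorphic functions with vanishing constant terms above `Y` are pseudo-cusp
forms**: if `G` is automorphic, square-integrable on `F`, and `∫₀¹ G(σ_i(x + iy)) dx = 0` for all
`y > Y` at every cusp, then `[G] ∈ L²_Y`. [cite: Garrett2018, §1.15, PDF p. 74] -/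
theorem toLp_mem_pseudoCuspSubmodule {G : ℍ → ℂ} (hGa : IsAutomorphic Γ G)
    (hG2 : MemLp G 2 ((volume : Measure ℍ).restrict F)) {Y : ℝ}
    (hcusp : ∀ (i : Fin h) (y : ℝ), Y < y → cuspMeanAt (σ i) G (UpperHalfPlane.ofComplex ⟨0, y⟩) = 0) :
    hG2.toLp G ∈ pseudoCuspSubmodule hΓ hneg hd hF σ Y := by
  intro i
  have h1 : autExt Γ F (⇑(hG2.toLp G)) =ᵐ[volume] autExt Γ F G :=
    autExt_congr_ae hΓ hneg hd hF (MemLp.coeFn_toLp hG2)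
  have h2 : autExt Γ F G =ᵐ[volume] G := autExt_ae_eq_of_isAutomorphic hΓ hneg hd hF hGa
  filter_upwards [cuspMeanAt_congr_ae (h1.trans h2) (σ i)] with w hw hY
  rw [hw, cuspMeanAt_eq_of_im (σ i) (hper i) hGa w, hcusp i w.im hY]

variable (hvol : volume F < ⊤)
  (hinfty : ∀ i, (Matrix.SpecialLinearGroup.toGL (σ i) : GL (Fin 2) ℝ) • (OnePoint.infty : OnePoint ℝ) = 𝔞 i)
  (hineq : ∀ i j, ∀ γ ∈ Γ, γ • 𝔞 i = 𝔞 j → i = j)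
  (hcomplete : ∀ c : OnePoint ℝ, IsCusp c Γ → ∃ i, ∃ γ ∈ Γ, γ • 𝔞 i = c)

include hvol hinfty hper hineq hcomplete in
/-- **The truncated Eisenstein series are pseudo-cusp forms**: for `Re s > 1` and `Y ≥ 1` the class
of `E^Y_𝔞ᵢ(·, s)` ((6.29)) lies in `L²_Y` (its constant terms vanish above `Y` at every cusp,
`cuspMeanAt_eisTrunc_eq_zero`). [cite: Iwaniec2002, (6.29), PDF p. 88; Garrett2018, §1.15, PDF p. 74] -/
theorem eisTrunc_mem_pseudoCuspSubmodule {s : ℂ} (hs : 1 < s.re) (i : Fin h) {Y : ℝ} (hY : 1 ≤ Y) :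
    (memLp_eisTrunc hΓ hneg hd hF hvol hinfty hper hineq hcomplete hs i hY).toLp (eisTrunc Γ σ i s Y) ∈
      pseudoCuspSubmodule hΓ hneg hd hF σ Y :=
  toLp_mem_pseudoCuspSubmodule hΓ hneg hd hF hper (isAutomorphic_eisTrunc hΓ i s Y) _
    fun j _ hy => cuspMeanAt_eisTrunc_eq_zero hΓ hneg hd hinfty hper hineq hs i j hY hy

end Classes

/-! ## 3. The compressed operators `T^Y_k = P_Y T_k P_Y` on `L²_Y` -/

section Operator

variable (hΓ : Γ ≤ (Matrix.SpecialLinearGroup.toGL : SL(2, ℝ) →* GL (Fin 2) ℝ).range)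
  (hneg : (-1 : GL (Fin 2) ℝ) ∈ Γ) (hd : IsDiscreteSubgroup Γ) (hF : IsHypFundamentalDomain Γ F)
  (σ : Fin h → SL(2, ℝ)) (Y : ℝ) {k k' : ℝ → ℝ}

/-- **The compressed invariant integral operator `T^Y_k = P_Y T_k|_{L²_Y}`** on the Hilbert space of
pseudo-cusp forms, `P_Y` the orthogonal projection of `L²(F)` onto `L²_Y` — the bounded
self-adjoint (below: compact) operator replacing, in our treatment of Chapter 6, Colin de Verdière's
pseudo-Laplacian `Δ̃_b` (the Friedrichs extension of `Δ` on `L²_b`, of compact resolvent).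
[cite: Garrett2018, §1.15 Thm 1.15.1, PDF p. 74; Iwaniec2002, §4.2 (Prop. p. 49) & §6.1, PDF pp. 49, 81] -/
def pseudoCuspKernelCLM (hk : IsTestKernel k) (hkc : Continuous k) :
    pseudoCuspSubmodule hΓ hneg hd hF σ Y →L[ℂ] pseudoCuspSubmodule hΓ hneg hd hF σ Y :=
  (pseudoCuspSubmodule hΓ hneg hd hF σ Y).orthogonalProjectionOnto.comp
    ((kernelCLM hΓ hneg hd hF hk hkc).comp (pseudoCuspSubmodule hΓ hneg hd hF σ Y).subtypeL)

/-- Unfolding: `T^Y_k f = P_Y (T_k f)`. [folklore] -/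
theorem pseudoCuspKernelCLM_apply (hk : IsTestKernel k) (hkc : Continuous k) (f : pseudoCuspSubmodule hΓ hneg hd hF σ Y) :
    pseudoCuspKernelCLM hΓ hneg hd hF σ Y hk hkc f =
      (pseudoCuspSubmodule hΓ hneg hd hF σ Y).orthogonalProjectionOnto
        (kernelCLM hΓ hneg hd hF hk hkc (f : Lp ℂ 2 ((volume : Measure ℍ).restrict F))) := rfl

/-- **`⟪T^Y_k f, g⟫ = ⟪T_k f, g⟫`** for pseudo-cusp forms `f, g`. [folklore] -/
theorem inner_pseudoCuspKernelCLM_left (hk : IsTestKernel k) (hkc : Continuous k)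
    (f g : pseudoCuspSubmodule hΓ hneg hd hF σ Y) :
    ⟪pseudoCuspKernelCLM hΓ hneg hd hF σ Y hk hkc f, g⟫_ℂ =
      ⟪kernelCLM hΓ hneg hd hF hk hkc (f : Lp ℂ 2 ((volume : Measure ℍ).restrict F)),
        (g : Lp ℂ 2 ((volume : Measure ℍ).restrict F))⟫_ℂ := by
  rw [pseudoCuspKernelCLM_apply, Submodule.inner_orthogonalProjectionOnto_eq_of_mem_right]

/-- **`⟪f, T^Y_k g⟫ = ⟪f, T_k g⟫`** for pseudo-cusp forms `f, g`. [folklore] -/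
theorem inner_pseudoCuspKernelCLM_right (hk : IsTestKernel k) (hkc : Continuous k)
    (f g : pseudoCuspSubmodule hΓ hneg hd hF σ Y) :
    ⟪f, pseudoCuspKernelCLM hΓ hneg hd hF σ Y hk hkc g⟫_ℂ =
      ⟪(f : Lp ℂ 2 ((volume : Measure ℍ).restrict F)),
        kernelCLM hΓ hneg hd hF hk hkc (g : Lp ℂ 2 ((volume : Measure ℍ).restrict F))⟫_ℂ := by
  rw [pseudoCuspKernelCLM_apply, Submodule.inner_orthogonalProjectionOnto_eq_of_mem_left]

/-- **`T^Y_k` is symmetric** (`T_k` is, Lemma 4.1 / §4.1, and `P_Y` is an orthogonal projection).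
[cite: Iwaniec2002, §4.1, PDF p. 48] -/
theorem pseudoCuspKernelCLM_isSymmetric (hk : IsTestKernel k) (hkc : Continuous k) :
    (pseudoCuspKernelCLM hΓ hneg hd hF σ Y hk hkc :
      pseudoCuspSubmodule hΓ hneg hd hF σ Y →ₗ[ℂ] pseudoCuspSubmodule hΓ hneg hd hF σ Y).IsSymmetric := by
  intro f g
  rw [ContinuousLinearMap.coe_coe, inner_pseudoCuspKernelCLM_left, inner_pseudoCuspKernelCLM_right]
  exact kernelCLM_isSymmetric hΓ hneg hd hF hk hkc _ _

/-- **`T^Y_k` is self-adjoint.** [cite: Iwaniec2002, §4.1, PDF p. 48] -/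
theorem isSelfAdjoint_pseudoCuspKernelCLM (hk : IsTestKernel k) (hkc : Continuous k) :
    IsSelfAdjoint (pseudoCuspKernelCLM hΓ hneg hd hF σ Y hk hkc) :=
  (pseudoCuspKernelCLM_isSymmetric hΓ hneg hd hF σ Y hk hkc).isSelfAdjoint

end Operator

/-! ## 4. Cusp decay of `T_k g` for pseudo-cusp forms `g` -/

section CuspDecay

variable (hΓ : Γ ≤ (Matrix.SpecialLinearGroup.toGL : SL(2, ℝ) →* GL (Fin 2) ℝ).range)
  (hneg : (-1 : GL (Fin 2) ℝ) ∈ Γ) (hd : IsDiscreteSubgroup Γ) (hF : IsHypFundamentalDomain Γ F)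
  (hinfty : ∀ i, (Matrix.SpecialLinearGroup.toGL (σ i) : GL (Fin 2) ℝ) • (OnePoint.infty : OnePoint ℝ) = 𝔞 i)
  (hper : ∀ i, (ConjAct.toConjAct (Matrix.SpecialLinearGroup.toGL (σ i) : GL (Fin 2) ℝ)⁻¹ • Γ).strictPeriods =
    AddSubgroup.zmultiples 1)
  (hineq : ∀ i j, ∀ γ ∈ Γ, γ • 𝔞 i = 𝔞 j → i = j)
  {k : ℝ → ℝ} {L : ℝ≥0} {M : ℝ}

/-- `L_k f(z) = 0` when `f` vanishes a.e. on the ball of radius `R_M` about `z` carrying the kernel.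
[folklore] -/
theorem invariantOperator_eq_zero_of_ae_ball (hM : ∀ u, M ≤ u → k u = 0) {f : ℍ → ℂ} {z : ℍ}
    (hf : ∀ᵐ w : ℍ, w ∈ Metric.closedBall z (kernelRadius M) → f w = 0) : invariantOperator k f z = 0 := by
  rw [invariantOperator_apply]
  have : (fun w : ℍ => (k (pointPairInv z w) : ℂ) * f w) =ᵐ[volume] fun _ => 0 := by
    filter_upwards [hf] with w hw
    by_cases hmem : w ∈ Metric.closedBall z (kernelRadius M)
    · rw [hw hmem, mul_zero]
    · rw [Metric.mem_closedBall, not_le, dist_comm] at hmem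
      rw [kernel_eq_zero_of_dist hM hmem]
      simp
  rw [integral_congr_ae this, integral_zero]

include hΓ hneg hd hF hinfty hper hineq in
/-- **Cusp decay of `T_k g` for a pseudo-cusp form `g` at the cusp `𝔞_i`**: for a Lipschitz test
kernel `k` (vanishing on `[M, ∞)`), `g ∈ L²(F)` whose cusp mean `(g^Γ)_{𝔞_i}` vanishes a.e. above
the height `Y`, and `z` with `e^{R_M+1} < Im z` and `Y < Im z · e^{-(R_M+1)}`: `|T_k g(σ_i z)| ≤ C_k (Im z)^{-1/2} ‖g‖_{L²(F)}` — the estimate of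
Propositions 4.3–4.5 (`norm_kernelOp_frame_le_of_cuspidal`), which only uses the vanishing of the
cusp mean on the ball of radius `R_M` about `z`. [cite: Iwaniec2002, Prop. 4.3, Cor. 4.4, Prop. 4.5, PDF pp. 49–51] -/
theorem norm_kernelOp_frame_le_of_pseudoCusp (hk : IsTestKernel k) (hL : LipschitzWith L k)
    (hM : ∀ u, M ≤ u → k u = 0) {g : ℍ → ℂ} (hg : MemLp g 2 (volume.restrict F)) (i : Fin h) {Y : ℝ}
    (hcusp : ∀ᵐ w : ℍ, Y < w.im → cuspMeanAt (σ i) (autExt Γ F g) w = 0) {z : ℍ}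
    (hz : Real.exp (kernelRadius M + 1) < z.im) (hzY : Y < z.im * Real.exp (-(kernelRadius M + 1))) :
    ‖kernelOp Γ F k g (σ i • z)‖ ≤
      frameCuspConst L M * z.im ^ (-(1 / 2 : ℝ)) * Real.sqrt ((∫⁻ w in F, ‖g w‖ₑ ^ 2).toReal) := by
  set R := kernelRadius M with hR
  set G : ℍ → ℂ := autExt Γ F g with hGdef
  set G' : ℍ → ℂ := fun v => G (σ i • v) with hG'def
  have hGl : LocallyIntegrable G := locallyIntegrable_autExt hΓ hneg hd hF hg
  have hGm : AEStronglyMeasurable G volume := aestronglyMeasurable_autExt hΓ hneg hd hF hg.1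
  have hG'l : LocallyIntegrable G' := locallyIntegrable_comp_sl_smul hGl (σ i)
  have hG'm : AEStronglyMeasurable G' volume := aestronglyMeasurable_comp_sl_smul hGm (σ i)
  set Φ : ℍ → ℂ := invariantOperator k G' with hΦdef
  have hΦc : Continuous Φ := continuous_invariantOperator hk hL hM hG'l
  -- `T_k g (σ_i z) = L_k G (σ_i z) = L_k G' (z)` and its cusp mean vanishes at `z`
  have eΦ : kernelOp Γ F k g (σ i • z) = Φ z := by
    rw [kernelOp_eq_invariantOperator hΓ hneg hd hF hk hg (σ i • z), hΦdef, hG'def,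
      invariantOperator_comp_smul k G (σ i) z]
  have hR0 : 0 ≤ R := kernelRadius_nonneg M
  have hy0 : 0 < z.im := z.im_pos
  have h0 : cuspMean Φ z = 0 := by
    rw [hΦdef, cuspMean_invariantOperator hk hG'l z]
    refine invariantOperator_eq_zero_of_ae_ball hM ?_
    filter_upwards [hcusp] with w hw hmem
    refine hw (lt_of_lt_of_le hzY ?_)
    refine le_trans ?_ (im_ge_of_mem_closedBall hmem)
    rw [← hR]
    gcongr
    linarith
  -- sizes
  have hy1 : 1 ≤ z.im := le_trans (by have := Real.one_le_exp (by linarith : (0:ℝ) ≤ R + 1); linarith) hz.le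
  have hzr : 1 < z.im * Real.exp (-(R + 1)) := by
    rw [Real.exp_neg, ← div_eq_mul_inv, lt_div_iff₀ (Real.exp_pos _), one_mul]
    exact hz
  set B := Metric.closedBall z (R + 1) with hB
  set m : ℝ := (∫⁻ w in F, ‖g w‖ₑ ^ 2).toReal with hm
  have hmfin : ∫⁻ w in F, ‖g w‖ₑ ^ 2 ≠ ∞ := (lintegral_enorm_sq_lt_top hg).ne
  set V : ℝ := (volume (Metric.closedBall UpperHalfPlane.I (R + 1))).toReal with hV
  -- mass of `G'` on the ball `B`
  have hmass := lintegral_sq_autExt_frame_closedBall_le hΓ hneg hd hF hinfty hper hineq i (z := z) (r := R + 1)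
    (by linarith) hzr hg.1
  have hBfin : ∫⁻ w in B, ‖G' w‖ₑ ^ 2 ≠ ∞ :=
    (lt_of_le_of_lt hmass (ENNReal.mul_lt_top ENNReal.ofReal_lt_top (lt_top_iff_ne_top.mpr hmfin))).ne
  have hvolB : volume B ≠ ∞ := (volume_closedBall_lt_top z (R + 1)).ne
  have hint : ∫ w in B, ‖G' w‖ ≤ Real.sqrt V * Real.sqrt ((2 * (z.im * (Real.exp (R + 1) - 1)) + 4) * m) := by
    refine (integral_norm_le_sqrt_mul_sqrt hvolB hG'm hBfin).trans ?_
    rw [hB, volume_closedBall_eq z (R + 1), ← hV]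
    gcongr
    have he : 0 ≤ Real.exp (R + 1) - 1 := by linarith [Real.one_le_exp (by linarith : (0:ℝ) ≤ R + 1)]
    have hpos : (0:ℝ) ≤ 2 * (z.im * (Real.exp (R + 1) - 1)) + 4 := by
      have := mul_nonneg hy0.le he; linarith
    rw [hm, ← ENNReal.toReal_ofReal hpos, ← ENNReal.toReal_mul]
    exact ENNReal.toReal_mono (ENNReal.mul_ne_top ENNReal.ofReal_ne_top hmfin) hmass
  -- oscillation along the horocycle
  have hosc : ∀ ξ ∈ Icc (0 : ℝ) 1, ‖Φ z - Φ (ξ +ᵥ z)‖ ≤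
      oscConst L M * (1 / z.im) * ∫ w in B, ‖G' w‖ := by
    intro ξ hξ
    have hdist : dist z (ξ +ᵥ z) ≤ 1 / z.im := by
      rw [dist_comm]
      refine (dist_vadd_self_le ξ z).trans ?_
      rw [abs_of_nonneg hξ.1]
      exact div_le_div_of_nonneg_right hξ.2 hy0.le
    have hdist1 : dist z (ξ +ᵥ z) ≤ 1 := hdist.trans (by rw [div_le_one hy0]; exact hy1)
    refine (norm_invariantOperator_sub_le hk hL hM hG'l hdist1).trans ?_
    have hI0 : 0 ≤ ∫ w in B, ‖G' w‖ := integral_nonneg fun w => norm_nonneg _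
    gcongr
    exact oscConst_nonneg L M
  have hmain := norm_le_of_cuspMean_eq_zero hΦc h0 hosc
  rw [eΦ]
  refine hmain.trans ?_
  have hsq : Real.sqrt ((2 * (z.im * (Real.exp (R + 1) - 1)) + 4) * m) ≤
      Real.sqrt z.im * Real.sqrt (2 * (Real.exp (R + 1) - 1) + 4) * Real.sqrt m := by
    have he : 0 ≤ Real.exp (R + 1) - 1 := by linarith [Real.one_le_exp (by linarith : (0:ℝ) ≤ R + 1)]
    have h24 : (0:ℝ) ≤ 2 * (Real.exp (R + 1) - 1) + 4 := by positivity
    rw [← Real.sqrt_mul hy0.le, ← Real.sqrt_mul (mul_nonneg hy0.le h24)]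
    apply Real.sqrt_le_sqrt
    have hm0 : 0 ≤ m := ENNReal.toReal_nonneg
    nlinarith
  have hy_half : (1 / z.im) * Real.sqrt z.im = z.im ^ (-(1 / 2 : ℝ)) := by
    rw [Real.sqrt_eq_rpow, Real.rpow_neg hy0.le, one_div, ← Real.rpow_neg_one, ← Real.rpow_add hy0]
    norm_num
    rw [Real.rpow_neg hy0.le]
  calc oscConst L M * (1 / z.im) * ∫ w in B, ‖G' w‖
      ≤ oscConst L M * (1 / z.im) * (Real.sqrt V * (Real.sqrt z.im * Real.sqrt (2 * (Real.exp (R + 1) - 1) + 4) * Real.sqrt m)) := by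
        have : 0 ≤ oscConst L M * (1 / z.im) := mul_nonneg (oscConst_nonneg L M) (one_div_pos.mpr hy0).le
        exact mul_le_mul_of_nonneg_left (hint.trans (mul_le_mul_of_nonneg_left hsq (Real.sqrt_nonneg _))) this
    _ = frameCuspConst L M * ((1 / z.im) * Real.sqrt z.im) * Real.sqrt m := by
        rw [frameCuspConst]; ring
    _ = frameCuspConst L M * z.im ^ (-(1 / 2 : ℝ)) * Real.sqrt m := by rw [hy_half]

end CuspDecay

/-! ## 5. Compactness of `T_k` on the pseudo-cusp forms and of `T^Y_k` -/

section Compact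

variable (hΓ : Γ ≤ (Matrix.SpecialLinearGroup.toGL : SL(2, ℝ) →* GL (Fin 2) ℝ).range)
  (hneg : (-1 : GL (Fin 2) ℝ) ∈ Γ) (hd : IsDiscreteSubgroup Γ) (hF : IsHypFundamentalDomain Γ F)
  (hvol : volume F < ⊤)
  (hinfty : ∀ i, (Matrix.SpecialLinearGroup.toGL (σ i) : GL (Fin 2) ℝ) • (OnePoint.infty : OnePoint ℝ) = 𝔞 i)
  (hper : ∀ i, (ConjAct.toConjAct (Matrix.SpecialLinearGroup.toGL (σ i) : GL (Fin 2) ℝ)⁻¹ • Γ).strictPeriods =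
    AddSubgroup.zmultiples 1)
  (hineq : ∀ i j, ∀ γ ∈ Γ, γ • 𝔞 i = 𝔞 j → i = j)
  (hcomplete : ∀ c : OnePoint ℝ, IsCusp c Γ → ∃ i, ∃ γ ∈ Γ, γ • 𝔞 i = c)
  {k : ℝ → ℝ} {L : ℝ≥0} {M : ℝ}

include hΓ hneg hd hF hvol hinfty hper hineq hcomplete in
/-- **`T_k` is compact on the pseudo-cusp forms of any height `Y₀`** (the analogue for `L²_{Y₀}` of
Iwaniec's §4.2–4.3 / of the compactness of the resolvent of the pseudo-Laplacian): for every
Lipschitz test kernel `k` the composite `T_k ∘ ι : L²_{Y₀} → L²(F)` is compact. Proof as for cusp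
forms (`isCompactOperator_kernelCLM_comp_cuspSubtype`): the image of the unit ball is totally bounded —
high in a cuspidal zone (above `e^{R_M+1}(|Y₀| + 1)`) `|T_k g| ≤ C_k (Im)^{-1/2}‖g‖` by the cusp decay
for pseudo-cusp forms, and the rest of `Γ\ℍ` is covered by a compact set on which `{T_k g}` is
uniformly bounded and equicontinuous. [cite: Iwaniec2002, Prop. 4.5 & §4.3, PDF pp. 50–52; Garrett2018, §1.15 Thm 1.15.1, PDF p. 74] -/
theorem isCompactOperator_kernelCLM_comp_pseudoCuspSubtype (hk : IsTestKernel k) (hL : LipschitzWith L k)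
    (hM : ∀ u, M ≤ u → k u = 0) (Y₀ : ℝ) :
    IsCompactOperator ((kernelCLM hΓ hneg hd hF hk hL.continuous).comp
      (pseudoCuspSubmodule hΓ hneg hd hF σ Y₀).subtypeL) := by
  haveI : IsFiniteMeasure ((volume : Measure ℍ).restrict F) :=
    ⟨by rw [Measure.restrict_apply_univ]; exact hvol⟩
  have hkc : Continuous k := hL.continuous
  obtain ⟨Bk, hBk⟩ := hk.bounded
  have hBk0 : 0 ≤ Bk := (abs_nonneg _).trans (hBk 0)
  set μF := (volume : Measure ℍ).restrict F with hμF
  set T := kernelCLM hΓ hneg hd hF hk hkc with hT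
  set 𝓒 := pseudoCuspSubmodule hΓ hneg hd hF σ Y₀ with h𝓒
  set ι := (𝓒.subtypeL : 𝓒 →L[ℂ] Lp ℂ 2 μF) with hι
  set R := kernelRadius M with hR
  refine (isCompactOperator_iff_isCompact_closure_image_closedBall
    ((T.comp ι : 𝓒 →L[ℂ] Lp ℂ 2 μF) : 𝓒 →ₗ[ℂ] Lp ℂ 2 μF) one_pos).mpr ?_
  rw [isCompact_iff_totallyBounded_isComplete]
  refine ⟨TotallyBounded.closure ?_, isClosed_closure.isComplete⟩
  rw [Metric.totallyBounded_iff]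
  intro ε hε
  -- constants
  set Λ : ℝ := (measureUnivNNReal μF : ℝ) ^ (2 : ℝ≥0∞).toReal⁻¹ with hΛ
  have hΛ0 : 0 ≤ Λ := by rw [hΛ]; positivity
  set β : ℝ := ε / (2 * (Λ + 1)) with hβ
  have hβ0 : 0 < β := by rw [hβ]; positivity
  set Ck := frameCuspConst L M with hCk
  have hCk0 : 0 ≤ Ck := frameCuspConst_nonneg L M
  -- the height of truncation
  set Y : ℝ := max (Real.exp (R + 1) * (|Y₀| + 1)) (((2 * Ck + 1) / β) ^ 2) with hY
  have hYexp : Real.exp (R + 1) ≤ Y :=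
    le_trans (le_mul_of_one_le_right (Real.exp_pos _).le (by linarith [abs_nonneg Y₀])) (le_max_left _ _)
  have hY0 : 0 < Y := lt_of_lt_of_le (Real.exp_pos _) hYexp
  have hYβ : 1 / Real.sqrt Y ≤ β / (2 * Ck + 1) := by
    have h1 : (2 * Ck + 1) / β ≤ Real.sqrt Y := by
      rw [Real.le_sqrt (by positivity) hY0.le]
      exact le_max_right _ _
    rw [div_le_div_iff₀ (Real.sqrt_pos.mpr hY0) (by positivity), one_mul]
    rw [div_le_iff₀ hβ0] at h1
    linarith
  -- the compact part `K_Y`, inside a ball `B(i, D₀)`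
  obtain ⟨K, hK, hKcover⟩ := exists_compact_of_invHeight_le (σ := σ) hΓ hneg hd hF hvol hinfty hper hcomplete Y
  obtain ⟨D₀, hD₀⟩ := hK.isBounded.subset_closedBall UpperHalfPlane.I
  -- the local constant on `K_Y` and the scale `δ`
  set A : ℝ := Real.sqrt ((volume (Metric.closedBall UpperHalfPlane.I (R + 1))).toReal) *
    Real.sqrt (orbitBoundAt Γ (D₀ + (R + 1)) / 2) with hA
  have hA0 : 0 ≤ A := by rw [hA]; unfold orbitBoundAt; positivity
  set δ : ℝ := min 1 (β / (4 * (oscConst L M * A) + 1)) with hδ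
  have hδ0 : 0 < δ := lt_min one_pos (div_pos hβ0 (by linarith [mul_nonneg (oscConst_nonneg L M) hA0]))
  have hδ1 : δ ≤ 1 := min_le_left _ _
  have hδβ : 2 * (oscConst L M * A) * δ ≤ β / 2 := by
    have h1 : δ ≤ β / (4 * (oscConst L M * A) + 1) := min_le_right _ _
    have h2 : 0 ≤ oscConst L M * A := mul_nonneg (oscConst_nonneg L M) hA0
    rw [le_div_iff₀ (by linarith)] at h1
    nlinarith
  -- finite `δ`-cover of the compact `K_Y`
  obtain ⟨t, hts, htf, hcov⟩ := finite_cover_balls_of_compact hK hδ0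
  haveI : Fintype t := htf.fintype
  -- point evaluations at the finitely many centres
  set Ψ : 𝓒 → (t → ℂ) := fun g i => kernelOp Γ F k (g : Lp ℂ 2 μF) (i : ℍ) with hΨ
  set ball𝓒 : Set 𝓒 := Metric.closedBall 0 1 with hball
  have hptbound : ∀ (g : Lp ℂ 2 μF) (z : ℍ), z ∈ K → ‖kernelOp Γ F k g z‖ ≤ Bk * A * ‖g‖ := by
    intro g z hz
    rw [kernelOp_eq_invariantOperator hΓ hneg hd hF hk (Lp.memLp g) z]
    have hGl := locallyIntegrable_autExt hΓ hneg hd hF (Lp.memLp g)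
    refine (norm_invariantOperator_le' hBk hM hGl z).trans ?_
    have hmono : ∫ w in Metric.closedBall z R, ‖autExt Γ F g w‖ ≤
        ∫ w in Metric.closedBall z (R + 1), ‖autExt Γ F g w‖ :=
      setIntegral_mono_set ((hGl.integrableOn_isCompact (isCompact_closedBall _ _)).norm)
        (Eventually.of_forall fun w => norm_nonneg _)
        (Eventually.of_forall (Metric.closedBall_subset_closedBall (by linarith)))
    have hloc := integral_norm_autExt_closedBall_le' hΓ hneg hd hF M (Lp.memLp g) (hD₀ hz)
    rw [← norm_eq_sqrt_lintegral' g, ← hR, ← hA] at hloc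
    rw [mul_assoc]
    exact mul_le_mul_of_nonneg_left (hmono.trans hloc) hBk0
  have hΨbdd : Ψ '' ball𝓒 ⊆ Metric.closedBall 0 (Bk * A) := by
    rintro _ ⟨g, hg, rfl⟩
    rw [Metric.mem_closedBall, dist_zero_right, pi_norm_le_iff_of_nonneg (by positivity)]
    intro i
    have hg1 : ‖(g : Lp ℂ 2 μF)‖ ≤ 1 := by
      rw [hball, Metric.mem_closedBall, dist_zero_right] at hg
      exact hg
    calc ‖Ψ g i‖ ≤ Bk * A * ‖(g : Lp ℂ 2 μF)‖ := hptbound g i (hts i.2)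
      _ ≤ Bk * A * 1 := by gcongr
      _ = Bk * A := mul_one _
  have hΨtb : TotallyBounded (Ψ '' ball𝓒) :=
    (isCompact_closedBall _ _).totallyBounded.subset hΨbdd
  obtain ⟨u, hu_sub, huf, hucov⟩ := hΨtb.exists_subset (Metric.dist_mem_uniformity (half_pos hβ0))
  have hpre : ∀ y ∈ u, ∃ g ∈ ball𝓒, Ψ g = y := fun y hy => hu_sub hy
  choose! gsel hgsel_mem hgsel_eq using hpre
  refine ⟨(fun y => (T.comp ι) (gsel y)) '' u, huf.image _, ?_⟩
  rintro _ ⟨g, hg, rfl⟩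
  obtain ⟨y, hyu, hy⟩ : ∃ y ∈ u, dist (Ψ g) y < β / 2 := by
    have := hucov ⟨g, hg, rfl⟩
    simpa only [mem_iUnion, mem_setOf_eq, exists_prop] using this
  rw [mem_iUnion₂]
  refine ⟨(T.comp ι) (gsel y), mem_image_of_mem _ hyu, ?_⟩
  rw [Metric.mem_ball, dist_eq_norm]
  change ‖(T.comp ι) g - (T.comp ι) (gsel y)‖ < ε
  rw [← map_sub]
  set hh : 𝓒 := g - gsel y with hhh
  have hg1 : ‖(g : Lp ℂ 2 μF)‖ ≤ 1 := by
    rw [hball, Metric.mem_closedBall, dist_zero_right] at hg; exact hg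
  have hgy1 : ‖(gsel y : Lp ℂ 2 μF)‖ ≤ 1 := by
    have := hgsel_mem y hyu
    rw [hball, Metric.mem_closedBall, dist_zero_right] at this; exact this
  have hh2 : ‖(hh : Lp ℂ 2 μF)‖ ≤ 2 := by
    rw [hhh, Submodule.coe_sub]
    exact (norm_sub_le _ _).trans (by linarith)
  have heval : ∀ i : t, ‖kernelOp Γ F k (hh : Lp ℂ 2 μF) (i : ℍ)‖ < β / 2 := by
    intro i
    rw [hhh, Submodule.coe_sub, kernelOp_coe_sub' hΓ hneg hd hF hk hkc]
    have h1 : dist (Ψ g) (Ψ (gsel y)) < β / 2 := by rw [hgsel_eq y hyu]; exact hy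
    have h2 := (dist_le_pi_dist (Ψ g) (Ψ (gsel y)) i).trans_lt h1
    rwa [dist_eq_norm] at h2
  -- pseudo-cuspidality and the automorphic extension of `h`
  have hhcusp : ∀ i, ∀ᵐ w : ℍ, Y₀ < w.im → cuspMeanAt (σ i) (autExt Γ F ((hh : Lp ℂ 2 μF) : ℍ → ℂ)) w = 0 :=
    (mem_pseudoCuspSubmodule_iff hΓ hneg hd hF σ Y₀ _).mp hh.2
  have hhmem : MemLp ((hh : Lp ℂ 2 μF) : ℍ → ℂ) 2 μF := Lp.memLp _
  have hHl := locallyIntegrable_autExt hΓ hneg hd hF hhmem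
  have hauto : IsAutomorphic Γ (kernelOp Γ F k ((hh : Lp ℂ 2 μF) : ℍ → ℂ)) := isAutomorphic_kernelOp hΓ hd hk _
  -- the pointwise bound `‖T_k h(z)‖ ≤ β` on the compact part
  have hcpt : ∀ z ∈ K, ‖kernelOp Γ F k (hh : Lp ℂ 2 μF) z‖ ≤ β := by
    intro z hzK
    obtain ⟨i, hit, hzi⟩ : ∃ i ∈ t, z ∈ Metric.ball i δ := by
      have := hcov hzK
      simpa only [mem_iUnion, exists_prop] using this
    have hdist : dist z i ≤ 1 := (le_of_lt (Metric.mem_ball.mp hzi)).trans hδ1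
    have hosc := norm_invariantOperator_sub_le hk hL hM hHl hdist
    have hloc := integral_norm_autExt_closedBall_le' hΓ hneg hd hF M hhmem (hD₀ hzK)
    rw [← norm_eq_sqrt_lintegral', ← hR, ← hA] at hloc
    have e1 := kernelOp_eq_invariantOperator hΓ hneg hd hF hk hhmem z
    have e2 := kernelOp_eq_invariantOperator hΓ hneg hd hF hk hhmem (i : ℍ)
    have hev := heval ⟨i, hit⟩
    calc ‖kernelOp Γ F k (hh : Lp ℂ 2 μF) z‖
        ≤ ‖kernelOp Γ F k (hh : Lp ℂ 2 μF) z - kernelOp Γ F k (hh : Lp ℂ 2 μF) i‖ +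
            ‖kernelOp Γ F k (hh : Lp ℂ 2 μF) i‖ := norm_le_norm_sub_add _ _
      _ ≤ oscConst L M * dist z i * (A * ‖(hh : Lp ℂ 2 μF)‖) + β / 2 := by
          refine add_le_add ?_ hev.le
          rw [e1, e2]
          refine hosc.trans ?_
          exact mul_le_mul_of_nonneg_left hloc (mul_nonneg (oscConst_nonneg L M) dist_nonneg)
      _ ≤ oscConst L M * δ * (A * 2) + β / 2 := by
          have hzi' : dist z i ≤ δ := le_of_lt (Metric.mem_ball.mp hzi)
          exact add_le_add (mul_le_mul (mul_le_mul_of_nonneg_left hzi' (oscConst_nonneg L M))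
            (mul_le_mul_of_nonneg_left hh2 hA0) (mul_nonneg hA0 (norm_nonneg _))
            (mul_nonneg (oscConst_nonneg L M) hδ0.le)) le_rfl
      _ = 2 * (oscConst L M * A) * δ + β / 2 := by ring
      _ ≤ β / 2 + β / 2 := by linarith
      _ = β := by ring
  -- the pointwise bound everywhere, by the height partition and automorphy
  have hpw : ∀ w : ℍ, ‖kernelOp Γ F k (hh : Lp ℂ 2 μF) w‖ ≤ β := by
    intro w
    by_cases hwY : invHeight Γ σ w ≤ Y
    · obtain ⟨γ, hγ, hγw⟩ := hKcover w hwY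
      rw [← hauto γ hγ w]
      exact hcpt _ hγw
    · push Not at hwY
      obtain ⟨γ, hγ, i, v, hv, e⟩ := exists_smul_mem_cuspStrip_of_lt hper hY0.le hwY
      have hvY : Y < v.im := hv.2.2
      rw [← hauto γ hγ w, ← e]
      have hvexp : Real.exp (R + 1) < v.im := lt_of_le_of_lt hYexp hvY
      have hvY₀ : Y₀ < v.im * Real.exp (-(R + 1)) := by
        have h1 : Real.exp (R + 1) * (|Y₀| + 1) ≤ Y := le_max_left _ _
        have h2 : (|Y₀| + 1) ≤ Y * Real.exp (-(R + 1)) := by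
          rw [Real.exp_neg, ← div_eq_mul_inv, le_div_iff₀ (Real.exp_pos _)]
          linarith [h1]
        have h3 : Y * Real.exp (-(R + 1)) < v.im * Real.exp (-(R + 1)) :=
          mul_lt_mul_of_pos_right hvY (Real.exp_pos _)
        have h4 : Y₀ ≤ |Y₀| := le_abs_self Y₀
        linarith
      have hc := norm_kernelOp_frame_le_of_pseudoCusp hΓ hneg hd hF hinfty hper hineq hk hL hM hhmem i (hhcusp i)
        hvexp hvY₀
      rw [← norm_eq_sqrt_lintegral', ← hCk, rpow_neg_one_half_eq_one_div_sqrt v.im_pos] at hc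
      refine le_trans (le_of_eq ?_) (hc.trans ?_)
      · rfl
      have h1 : 1 / Real.sqrt v.im ≤ 1 / Real.sqrt Y :=
        one_div_le_one_div_of_le (Real.sqrt_pos.mpr hY0) (Real.sqrt_le_sqrt hvY.le)
      calc Ck * (1 / Real.sqrt v.im) * ‖(hh : Lp ℂ 2 μF)‖ ≤ Ck * (β / (2 * Ck + 1)) * 2 :=
            mul_le_mul (mul_le_mul_of_nonneg_left (h1.trans hYβ) hCk0) hh2 (norm_nonneg _)
              (mul_nonneg hCk0 (by positivity))
        _ ≤ β := by
            rw [mul_div_assoc', div_mul_eq_mul_div, div_le_iff₀ (by linarith)]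
            nlinarith
  -- integrate the pointwise bound
  have hae : ∀ᵐ w ∂μF, ‖(T (hh : Lp ℂ 2 μF)) w‖ ≤ β := by
    have h1 := kernelCLM_coeFn hΓ hneg hd hF hk hkc (hh : Lp ℂ 2 μF)
    filter_upwards [h1] with w hw1
    rw [hT, hw1]
    exact hpw w
  have hnorm := Lp.norm_le_of_ae_bound hβ0.le hae
  rw [← hΛ] at hnorm
  have e : (T.comp ι) hh = T (hh : Lp ℂ 2 μF) := rfl
  rw [e]
  calc ‖T (hh : Lp ℂ 2 μF)‖ ≤ Λ * β := hnorm
    _ ≤ (Λ + 1) * β := by gcongr; linarith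
    _ = ε / 2 := by rw [hβ]; field_simp
    _ < ε := half_lt_self hε

include hvol hinfty hper hineq hcomplete in
/-- **`T^Y_k = P_Y T_k P_Y` is a compact operator on `L²_Y`** for every Lipschitz test kernel (the
substitute for the compactness of the resolvent of the pseudo-Laplacian, Garrett Thm 1.15.1 / Colin
de Verdière). [cite: Garrett2018, §1.15 Thm 1.15.1, PDF p. 74; Iwaniec2002, Prop. 4.5 & §4.3, PDF pp. 50–52] -/
theorem isCompactOperator_pseudoCuspKernelCLM (hk : IsTestKernel k) (hL : LipschitzWith L k)
    (hM : ∀ u, M ≤ u → k u = 0) (Y₀ : ℝ) :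
    IsCompactOperator (pseudoCuspKernelCLM hΓ hneg hd hF σ Y₀ hk hL.continuous) := by
  have h := (isCompactOperator_kernelCLM_comp_pseudoCuspSubtype hΓ hneg hd hF hvol hinfty hper hineq hcomplete
    hk hL hM Y₀).clm_comp (pseudoCuspSubmodule hΓ hneg hd hF σ Y₀).orthogonalProjectionOnto
  exact h

end Compact

end Fuchsian

end Literature.NumberTheory.Automorphic
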